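import Summits.BirchSwinnertonDyer.BirchSwinnertonDyer.Theorems.ThetaPartnerAtTwoSignedTransportAtTwoHondaOmega
import Summits.BirchSwinnertonDyer.Rank1Residual.Additive.PadicBallLog
import Literature.NumberTheory.EllipticCurves.FormalGroupDictionaryProofs
import HarnessLib

/-!
# Prime-to-`p` division in `E₁(ℚ̄_p)` and the equivariant retraction `E(ℚ̄_p) → E₁(ℚ̄_p)` — for the crux `SignedTransportAtTwo`
# (stmt-BirchSwinnertonDyer-20333, route `ThetaPartnerAtTwo`, line `bridge` v16, stub `stub_sel2Tb`, step T3)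
# (lead prover bsd-wall-tp2-p1 g5; `--supports stmt-BirchSwinnertonDyer-20333`; route-independent, closes nothing)

HONEST FRAMING. THEOREMS ONLY (no definition); nothing about any Selmer group is asserted; BSD is not proved by any of this.
No import of any route file.

WHAT (`Ω = ℚ̄_p`, `M / ℤ_p` with elliptic generic fibre, `E₁ = FormalGroupChart.kernel` of `M ⊗ Ω`).
* §1 Over a complete `K`: **`E₁(K)` is uniquely `m`-divisible for `p ∤ m`** (`[m] = mX + ⋯ ∈ ℤ_p⟦X⟧` has a substitution inverse
  since `m ∈ ℤ_p^×`; evaluate with the tree's dictionary `z(n • P) = [n](z P)`): `exists_nsmul_eq_of_not_dvd`,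
  `eq_zero_of_nsmul_eq_zero_of_not_dvd`. (Silverman IV.2.3(b)/IV.3.2: `[m]` is an automorphism of `Ê` for `m` prime to `p`.)
* §2 The same over `Ω` (every point of `E₁(Ω)` comes from a complete subfield, file `…HondaOmega` §1).
* §3 **The retraction.** If every `P ∈ E(Ω)` has a prime-to-`p` multiple in `E₁(Ω)` (`hsat`; at a good supersingular prime this
  is reduction modulo `𝔪`, `Ẽ(𝔽̄_p)` being prime-to-`p` torsion), then `E(Ω) = E₁(Ω) ⊕ E(Ω)[p']` and the projection
  `r : E(Ω) → E₁(Ω)` is an additive retraction commuting with `Aut(Ω/ℚ_p)` (`exists_retraction`): `r P` is the unique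
  `Q ∈ E₁` with `m • Q = m • P`.

References: [SilvermanAEC2009] IV.2.3(b), IV.3.2(b), VII.2.1–2.2, VII.3.1; [Kobayashi2003] §8.4; [BDKim2009] Prop. 2.11–2.12.
-/

set_option autoImplicit false
-- D-0017: single-problem summit, so `Summit.BirchSwinnertonDyer.BirchSwinnertonDyer.…` repeats a namespace BY DESIGN.
set_option linter.dupNamespace false

noncomputable section

open scoped Classical NNReal Topology

open PowerSeries WeierstrassCurve Literature.RingTheory.FormalGroups Literature.NumberTheory.EllipticCurves
  Literature.NumberTheory.EllipticCurves.FormalGroupChart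
  Summit.BirchSwinnertonDyer.Rank1Residual.Additive Summit.BirchSwinnertonDyer.Rank1Residual.Additive.BallEval
  Literature.NumberTheory.GaloisRepresentations.LubinTate

namespace Summit.BirchSwinnertonDyer.BirchSwinnertonDyer.Theorems.SignedTransportAtTwo

variable {p : ℕ} [hp : Fact p.Prime]

/-! ## §1 Prime-to-`p` division in `E₁(K)`, `K` complete -/

section Complete

variable {K : Type*} [NontriviallyNormedField K] [NormedAlgebra ℚ_[p] K] [IsUltrametricDist K] [CompleteSpace K]
  (M : WeierstrassCurve ℤ_[p]) [hE : (M.map PadicInt.Coe.ringHom).IsElliptic]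
  [hint : (curveK p K M).IsIntegral (NormedField.valuation (K := K)).integer]

omit hE hint in
/-- `[m] = mX + ⋯` has unit linear coefficient in `ℤ_p` when `p ∤ m`. [cite: SilvermanAEC2009, IV.2.3] -/
theorem isUnit_coeff_one_formalMul {m : ℕ} (hm : ¬ p ∣ m) : IsUnit (coeff 1 (M.formalMul m)) := by
  -- `coeff 1 [m] = m`, read over `ℚ_p`
  haveI : (M.map (PadicInt.Coe.ringHom (p := p))).IsIntegral ℤ_[p] :=
    ⟨⟨M, by rw [WeierstrassCurve.baseChange, algebraMap_padicInt_eq]⟩⟩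
  have hq : ((coeff 1 (M.formalMul m) : ℤ_[p]) : ℚ_[p]) = m := by
    have h := congrArg (coeff 1) (M.map_formalMul (PadicInt.Coe.ringHom (p := p)) m)
    rw [coeff_map, (M.map (PadicInt.Coe.ringHom (p := p))).coeff_one_formalMul m] at h
    exact h
  rw [PadicInt.isUnit_iff]
  have h1 : ‖((m : ℤ) : ℤ_[p])‖ = 1 := by
    rcases (PadicInt.norm_le_one ((m : ℤ) : ℤ_[p])).lt_or_eq with h | h
    · exact absurd ((PadicInt.norm_int_lt_one_iff_dvd (m : ℤ)).mp h) (by exact_mod_cast hm)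
    · exact h
  have hc : (coeff 1 (M.formalMul m) : ℤ_[p]) = ((m : ℤ) : ℤ_[p]) := by
    apply Subtype.ext
    rw [hq]
    simp
  rw [hc, h1]

/-- **Division by `m` prime to `p` in `E₁(K)`**: for `P ∈ E₁(K)` there is `Q ∈ E₁(K)` with `m • Q = P`
(`Q = P_K([m]⁻¹(z P))`). [cite: SilvermanAEC2009, IV.2.3 and Prop. VII.2.2] -/
theorem exists_nsmul_eq_of_not_dvd {m : ℕ} (hm : ¬ p ∣ m) {P : (curveK p K M).toAffine.Point}
    (hP : P ∈ kernel (NormedField.valuation (K := K)) (curveK p K M)) :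
    ∃ Q : (curveK p K M).toAffine.Point, Q ∈ kernel (NormedField.valuation (K := K)) (curveK p K M) ∧ m • Q = P := by
  have hu := isUnit_coeff_one_formalMul (p := p) M hm
  set inv := (M.formalMul m).substInvOfIsUnit hu with hinv
  have hinv0 : constantCoeff inv = 0 := constantCoeff_substInvOfIsUnit _ hu
  have hright : (M.formalMul m).subst inv = PowerSeries.X := subst_substInvOfIsUnit_right _ (M.constantCoeff_formalMul m) hu
  have ht := norm_zBall_lt_one hP
  have hs : ‖((ev₁ p K (zBall P hP) (hasEval_of_norm_lt_one ht) inv : unitBall K) : K)‖ < 1 :=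
    (norm_ev₁_le _ ht.le hinv0).trans_lt ht
  refine ⟨ptOf p K M _ hs, ptOf_mem_kernel _, ?_⟩
  have hQ : ptOf p K M _ hs ∈ kernel (NormedField.valuation (K := K)) (curveK p K M) := ptOf_mem_kernel _
  refine eq_of_zCoord_eq ((kernel (NormedField.valuation (K := K)) (curveK p K M)).nsmul_mem hQ m) hP ?_
  rw [zCoord_nsmul_eq_ev₁_formalMul hQ m]
  have hzb : zBall (ptOf p K M _ hs) hQ = ev₁ p K (zBall P hP) (hasEval_of_norm_lt_one ht) inv := Subtype.ext (zCoord_ptOf hs)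
  rw [ev₁_congr hzb _ (hasEval_of_norm_lt_one hs), ← ev₁_subst hinv0 (hasEval_of_norm_lt_one ht), hright, ev₁_X]
  rfl

/-- **No prime-to-`p` torsion in `E₁(K)`**: `m • Q = O` with `p ∤ m` and `Q ∈ E₁(K)` forces `Q = O`
(`z Q = [m]⁻¹([m](z Q)) = [m]⁻¹(0) = 0`). [cite: SilvermanAEC2009, Prop. VII.3.1(a)] -/
theorem eq_zero_of_nsmul_eq_zero_of_not_dvd {m : ℕ} (hm : ¬ p ∣ m) {Q : (curveK p K M).toAffine.Point}
    (hQ : Q ∈ kernel (NormedField.valuation (K := K)) (curveK p K M)) (h0 : m • Q = 0) : Q = 0 := by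
  have hu := isUnit_coeff_one_formalMul (p := p) M hm
  set inv := (M.formalMul m).substInvOfIsUnit hu with hinv
  have hinv0 : constantCoeff inv = 0 := constantCoeff_substInvOfIsUnit _ hu
  have hleft : inv.subst (M.formalMul m) = PowerSeries.X := subst_substInvOfIsUnit_left _ (M.constantCoeff_formalMul m) hu
  have ht := norm_zBall_lt_one hQ
  -- `[m](z Q) = z(m • Q) = 0`
  have hm0 : ((ev₁ p K (zBall Q hQ) (hasEval_of_norm_lt_one ht) (M.formalMul m) : unitBall K) : K) = 0 := by
    rw [← zCoord_nsmul_eq_ev₁_formalMul hQ m, h0, Affine.Point.zCoord_zero]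
  have hm0' : ev₁ p K (zBall Q hQ) (hasEval_of_norm_lt_one ht) (M.formalMul m) = 0 := Subtype.ext hm0
  have h00 : ‖((0 : unitBall K) : K)‖ < 1 := by simp
  have hmt : ‖((ev₁ p K (zBall Q hQ) (hasEval_of_norm_lt_one ht) (M.formalMul m) : unitBall K) : K)‖ < 1 := by
    rw [hm0]; simp
  -- `z Q = [m]⁻¹([m] (z Q)) = [m]⁻¹(0)`
  have hz : zBall Q hQ = ev₁ p K (0 : unitBall K) (hasEval_of_norm_lt_one h00) inv := by
    have h1 : ev₁ p K (zBall Q hQ) (hasEval_of_norm_lt_one ht) (inv.subst (M.formalMul m)) = zBall Q hQ := by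
      rw [hleft, ev₁_X]
    rw [← h1, ev₁_subst (M.constantCoeff_formalMul m) (hasEval_of_norm_lt_one ht) (hasEval_of_norm_lt_one hmt)]
    exact ev₁_congr hm0' _ _ _
  have hnorm : ‖((ev₁ p K (0 : unitBall K) (hasEval_of_norm_lt_one h00) inv : unitBall K) : K)‖ ≤ ‖((0 : unitBall K) : K)‖ :=
    norm_ev₁_le _ h00.le hinv0
  have hz0 : Q.zCoord = 0 := by
    rw [← coe_zBall hQ, hz]
    have : ‖((0 : unitBall K) : K)‖ = 0 := by simp
    rw [this] at hnorm
    exact norm_le_zero_iff.mp hnorm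
  exact (zCoord_eq_zero_iff hQ).mp hz0

end Complete

/-! ## §2 Prime-to-`p` division in `E₁(Ω)` -/

section DecEq

variable {F : Type*} [Field F] (W : WeierstrassCurve F)

/-- Point arithmetic does not depend on the `DecidableEq` instance used to define it (the generic theory uses the classical
one, subfields of `Ω` carry `Subtype.instDecidableEq`). [folklore] -/
theorem nsmul_point_congr_dec (d₁ d₂ : DecidableEq F) (m : ℕ) (P : W.toAffine.Point) :
    (letI : DecidableEq F := d₁; m • P) = (letI : DecidableEq F := d₂; m • P) := by
  obtain rfl : d₁ = d₂ := Subsingleton.elim _ _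
  rfl

end DecEq

section Omega

variable (M : WeierstrassCurve ℤ_[p]) [hE : (M.map PadicInt.Coe.ringHom).IsElliptic]
  [hintΩ : ((M.map (PadicInt.Coe.ringHom (p := p))).baseChange (PadicAlgCl p)).IsIntegral (Valued.v (R := PadicAlgCl p)).integer]

/-- Every point of `E₁(Ω)` is `val P_F(t)` for the complete subfield `F = ℚ_p(z P)` and `t = z P`. [cite: SilvermanAEC2009, Prop. VII.2.2] -/
theorem exists_eq_map_ptOf {P : ((M.map (PadicInt.Coe.ringHom (p := p))).baseChange (PadicAlgCl p)).toAffine.Point}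
    (hP : P ∈ kernel (Valued.v (R := PadicAlgCl p)) ((M.map (PadicInt.Coe.ringHom (p := p))).baseChange (PadicAlgCl p))) :
    ∃ (F : IntermediateField ℚ_[p] (PadicAlgCl p)) (_ : CompleteSpace F) (t : unitBall F) (ht : ‖(t : F)‖ < 1),
      P = Affine.Point.map (W' := M.map (PadicInt.Coe.ringHom (p := p))) (IntermediateField.val F) (ptOf p F M t ht) := by
  set z := P.zCoord with hz
  set F : IntermediateField ℚ_[p] (PadicAlgCl p) := IntermediateField.adjoin ℚ_[p] {z} with hF
  haveI : FiniteDimensional ℚ_[p] F := IntermediateField.adjoin.finiteDimensional (Algebra.IsIntegral.isIntegral z)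
  haveI : CompleteSpace F := FiniteDimensional.complete ℚ_[p] F
  haveI := isIntegral_curveK p F M
  have hzF : z ∈ F := IntermediateField.mem_adjoin_simple_self ℚ_[p] z
  have hz1 := norm_zCoord_lt_one_of_mem M F hP hzF
  exact ⟨F, inferInstance, ⟨⟨z, hzF⟩, (mem_unitBall_iff F).mpr hz1.le⟩, hz1, eq_map_ptOf_of_zCoord_mem M F hP hzF hz1⟩

/-- **Division by `m` prime to `p` in `E₁(Ω)`.** [cite: SilvermanAEC2009, IV.2.3 and Prop. VII.2.2] -/
theorem exists_nsmul_eq_of_not_dvd_Ω {m : ℕ} (hm : ¬ p ∣ m)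
    {P : ((M.map (PadicInt.Coe.ringHom (p := p))).baseChange (PadicAlgCl p)).toAffine.Point}
    (hP : P ∈ kernel (Valued.v (R := PadicAlgCl p)) ((M.map (PadicInt.Coe.ringHom (p := p))).baseChange (PadicAlgCl p))) :
    ∃ Q : ((M.map (PadicInt.Coe.ringHom (p := p))).baseChange (PadicAlgCl p)).toAffine.Point,
      Q ∈ kernel (Valued.v (R := PadicAlgCl p)) ((M.map (PadicInt.Coe.ringHom (p := p))).baseChange (PadicAlgCl p)) ∧
        m • Q = P := by
  obtain ⟨F, _, t, ht, hPt⟩ := exists_eq_map_ptOf M hP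
  haveI := isIntegral_curveK p F M
  have hP₀ : ptOf p F M t ht ∈ kernel (NormedField.valuation (K := F)) (curveK p F M) := ptOf_mem_kernel _
  obtain ⟨Q₀, hQ₀, hmQ₀⟩ := exists_nsmul_eq_of_not_dvd (K := F) M hm hP₀
  refine ⟨Affine.Point.map (W' := M.map (PadicInt.Coe.ringHom (p := p))) (IntermediateField.val F) Q₀,
    (map_val_mem_kernel_iff M F Q₀).mpr hQ₀, ?_⟩
  have h1 : Affine.Point.map (W' := M.map (PadicInt.Coe.ringHom (p := p))) (IntermediateField.val F) (m • Q₀) =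
      m • Affine.Point.map (W' := M.map (PadicInt.Coe.ringHom (p := p))) (IntermediateField.val F) Q₀ := map_nsmul _ _ _
  have h2 : m • Q₀ = (letI : DecidableEq F := fun a b ↦ Classical.propDecidable _; m • Q₀) :=
    nsmul_point_congr_dec (curveK p F M) _ _ m Q₀
  rw [← h1, h2, hPt]
  exact congrArg _ hmQ₀

/-- **No prime-to-`p` torsion in `E₁(Ω)`.** [cite: SilvermanAEC2009, Prop. VII.3.1(a)] -/
theorem eq_zero_of_nsmul_eq_zero_of_not_dvd_Ω {m : ℕ} (hm : ¬ p ∣ m)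
    {Q : ((M.map (PadicInt.Coe.ringHom (p := p))).baseChange (PadicAlgCl p)).toAffine.Point}
    (hQ : Q ∈ kernel (Valued.v (R := PadicAlgCl p)) ((M.map (PadicInt.Coe.ringHom (p := p))).baseChange (PadicAlgCl p)))
    (h0 : m • Q = 0) : Q = 0 := by
  obtain ⟨F, _, t, ht, hQt⟩ := exists_eq_map_ptOf M hQ
  haveI := isIntegral_curveK p F M
  have hQ₀ : ptOf p F M t ht ∈ kernel (NormedField.valuation (K := F)) (curveK p F M) := ptOf_mem_kernel _
  have h0' : m • ptOf p F M t ht = 0 := by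
    apply Affine.Point.map_injective (W' := M.map (PadicInt.Coe.ringHom (p := p))) (IntermediateField.val F)
    have h1 : Affine.Point.map (W' := M.map (PadicInt.Coe.ringHom (p := p))) (IntermediateField.val F) (m • ptOf p F M t ht) =
        m • Affine.Point.map (W' := M.map (PadicInt.Coe.ringHom (p := p))) (IntermediateField.val F) (ptOf p F M t ht) :=
      map_nsmul _ _ _
    have h2 : Affine.Point.map (W' := M.map (PadicInt.Coe.ringHom (p := p))) (IntermediateField.val F)
        (0 : (curveK p F M).toAffine.Point) = 0 := map_zero _
    rw [h1, h2, ← hQt, h0]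
  have h0c : (letI : DecidableEq F := fun a b ↦ Classical.propDecidable _; m • ptOf p F M t ht) = 0 := by
    rw [← nsmul_point_congr_dec (curveK p F M) inferInstance _ m]; exact h0'
  have h00 : ptOf p F M t ht = 0 := eq_zero_of_nsmul_eq_zero_of_not_dvd (K := F) M hm hQ₀ h0c
  have h2 : Affine.Point.map (W' := M.map (PadicInt.Coe.ringHom (p := p))) (IntermediateField.val F)
      (0 : (curveK p F M).toAffine.Point) = 0 := map_zero _
  rw [hQt, h00, h2]

/-! ## §3 The retraction `E(Ω) → E₁(Ω)` -/

/-- **The equivariant retraction onto `E₁(Ω)`.** If every point of `E(Ω) = (M ⊗ Ω)(Ω)` has a prime-to-`p` multiple in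
`E₁(Ω)` (`hsat`), there is an additive `r : E(Ω) → E₁(Ω)` with `r P = P` on `E₁(Ω)`, `m • r P = m • P` whenever
`m • P ∈ E₁(Ω)` with `p ∤ m` (so `r` kills the prime-to-`p` torsion and `E(Ω) = E₁(Ω) ⊕ E(Ω)[p']`), commuting with every
`σ ∈ Aut(Ω/ℚ_p)`. [cite: SilvermanAEC2009, VII.2.1–2.2 and VII.3.1] [cite: Kobayashi2003, §8.4] -/
theorem exists_retraction
    (hsat : ∀ P : ((M.map (PadicInt.Coe.ringHom (p := p))).baseChange (PadicAlgCl p)).toAffine.Point,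
      ∃ m : ℕ, ¬ p ∣ m ∧ m • P ∈ kernel (Valued.v (R := PadicAlgCl p)) ((M.map (PadicInt.Coe.ringHom (p := p))).baseChange (PadicAlgCl p))) :
    ∃ r : ((M.map (PadicInt.Coe.ringHom (p := p))).baseChange (PadicAlgCl p)).toAffine.Point →+
        ↥(kernel (Valued.v (R := PadicAlgCl p)) ((M.map (PadicInt.Coe.ringHom (p := p))).baseChange (PadicAlgCl p))),
      (∀ P (hP : P ∈ kernel (Valued.v (R := PadicAlgCl p)) ((M.map (PadicInt.Coe.ringHom (p := p))).baseChange (PadicAlgCl p))),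
        r P = ⟨P, hP⟩) ∧
      (∀ (P : ((M.map (PadicInt.Coe.ringHom (p := p))).baseChange (PadicAlgCl p)).toAffine.Point) (m : ℕ), ¬ p ∣ m →
        m • P ∈ kernel (Valued.v (R := PadicAlgCl p)) ((M.map (PadicInt.Coe.ringHom (p := p))).baseChange (PadicAlgCl p)) →
        m • (r P : ((M.map (PadicInt.Coe.ringHom (p := p))).baseChange (PadicAlgCl p)).toAffine.Point) = m • P) ∧
      (∀ (σ : PadicAlgCl p ≃ₐ[ℚ_[p]] PadicAlgCl p) (P : ((M.map (PadicInt.Coe.ringHom (p := p))).baseChange (PadicAlgCl p)).toAffine.Point),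
        (r (Affine.Point.map (σ : PadicAlgCl p →ₐ[ℚ_[p]] PadicAlgCl p) P) :
            ((M.map (PadicInt.Coe.ringHom (p := p))).baseChange (PadicAlgCl p)).toAffine.Point) =
          Affine.Point.map (σ : PadicAlgCl p →ₐ[ℚ_[p]] PadicAlgCl p) (r P)) := by
  set V := (M.map (PadicInt.Coe.ringHom (p := p))).baseChange (PadicAlgCl p) with hV
  set ker := kernel (Valued.v (R := PadicAlgCl p)) V with hker
  -- uniqueness of the candidate
  have huniq : ∀ {P Q Q' : V.toAffine.Point} {m m' : ℕ}, ¬ p ∣ m → ¬ p ∣ m' → Q ∈ ker → Q' ∈ ker →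
      m • Q = m • P → m' • Q' = m' • P → Q = Q' := by
    intro P Q Q' m m' hm hm' hQ hQ' h1 h2
    have hmm : ¬ p ∣ m * m' := fun h ↦ (hp.out.dvd_mul.mp h).elim hm hm'
    have h3 : (m * m') • (Q - Q') = 0 := by
      rw [nsmul_sub, mul_comm, mul_smul, h1, mul_comm, mul_smul, h2, ← mul_smul, ← mul_smul, mul_comm, sub_self]
    have h4 := eq_zero_of_nsmul_eq_zero_of_not_dvd_Ω M hmm (ker.sub_mem hQ hQ') h3
    exact sub_eq_zero.mp h4
  -- existence of the candidate
  have hex : ∀ P : V.toAffine.Point, ∃ Q : V.toAffine.Point, Q ∈ ker ∧ ∃ m : ℕ, ¬ p ∣ m ∧ m • Q = m • P := by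
    intro P
    obtain ⟨m, hm, hmP⟩ := hsat P
    obtain ⟨Q, hQ, hmQ⟩ := exists_nsmul_eq_of_not_dvd_Ω M hm hmP
    exact ⟨Q, hQ, m, hm, hmQ⟩
  choose rf hrk hrm using hex
  -- `m • rf P = m • P` for EVERY admissible `m`
  have hr : ∀ (P : V.toAffine.Point) (m : ℕ), ¬ p ∣ m → m • P ∈ ker → m • rf P = m • P := by
    intro P m hm hmP
    obtain ⟨m₀, hm₀, h₀⟩ := hrm P
    obtain ⟨Q, hQ, hmQ⟩ := exists_nsmul_eq_of_not_dvd_Ω M hm hmP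
    rw [huniq hm₀ hm (hrk P) hQ h₀ hmQ, hmQ]
  have hadd : ∀ P P' : V.toAffine.Point, rf (P + P') = rf P + rf P' := by
    intro P P'
    obtain ⟨m, hm, h1⟩ := hrm P
    obtain ⟨m', hm', h2⟩ := hrm P'
    obtain ⟨n, hn, h3⟩ := hrm (P + P')
    have hmm : ¬ p ∣ m * m' := fun h ↦ (hp.out.dvd_mul.mp h).elim hm hm'
    refine huniq hn hmm (hrk _) (ker.add_mem (hrk P) (hrk P')) h3 ?_
    rw [nsmul_add, nsmul_add]
    congr 1
    · rw [mul_comm, mul_smul, h1, ← mul_smul]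
    · rw [mul_smul, h2, ← mul_smul]
  let r : V.toAffine.Point →+ ↥ker :=
    AddMonoidHom.mk' (fun P ↦ ⟨rf P, hrk P⟩) fun P P' ↦ Subtype.ext (hadd P P')
  refine ⟨r, fun P hP ↦ ?_, fun P m hm hmP ↦ hr P m hm hmP, fun σ P ↦ ?_⟩
  · -- `r P = P` on `E₁`
    obtain ⟨m, hm, h1⟩ := hrm P
    exact Subtype.ext (huniq hm hm (hrk P) hP h1 rfl)
  · -- equivariance
    obtain ⟨m, hm, h1⟩ := hrm P
    obtain ⟨n, hn, h2⟩ := hrm (Affine.Point.map (σ : PadicAlgCl p →ₐ[ℚ_[p]] PadicAlgCl p) P)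
    change rf _ = Affine.Point.map (σ : PadicAlgCl p →ₐ[ℚ_[p]] PadicAlgCl p) (rf P)
    refine huniq hn hm (hrk _) ((pointMap_mem_kernel_iff M σ _).mpr (hrk P)) h2 ?_
    rw [← map_nsmul, h1, map_nsmul]

end Omega

end Summit.BirchSwinnertonDyer.BirchSwinnertonDyer.Theorems.SignedTransportAtTwo

end
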